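import Summits.HubbardSuperconductivity.HubbardSuperconductivity.Theorems.BalabanIRBirComplexStableXYWitnessContinuity
import Mathlib.Analysis.Calculus.ParametricIntegral

/-!
# Holomorphy of the witness partition function in the complex temporal stiffness
(`BalabanIR.BirComplexStableXY`, stmt-HubbardSuperconductivity-2080, line `theta-rotor-equimodular-zeros`)

For the stiffness-deformed witness table
`c_a = spatialTab + a • temporalCosTab + (iε₂) • temporalSinTab` (`a ∈ ℂ` the complex temporal
stiffness) of the negative lane (`Theorems/BirComplexStableXY/Negative/WitnessTable.lean`), the crux's
partition function `a ↦ Z = partZ K c_a L M = ∫_cube e^{-A}` is an ENTIRE function of `a`.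

Proof.  The action is affine in `a`: `A(c_a)(θ) = A₀(θ) + a · A₁(θ)` with
`A₀ = A(spatialTab) + iε₂ A(temporalSinTab)` and `A₁ = A(temporalCosTab)` (linearity of the generating
function `F` in the table, `genF_add` / `genF_smul`), and `A₀, A₁` are continuous in the configuration
`θ`.  Hence the integrand `e^{-(A₀ + a A₁)}` is entire in `a` with derivative `-A₁ e^{-(A₀ + a A₁)}`,
which on the ball `‖a - a₀‖ < 1` is dominated by the continuous (hence integrable on the compact cube)
function `‖A₁‖ exp (‖A₀‖ + (‖a₀‖ + 1) ‖A₁‖)`; differentiation under the integral sign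
(`hasDerivAt_integral_of_dominated_loc_of_deriv_le`) gives the complex derivative at every `a₀`.
No definitions, no hypotheses; `K` is an arbitrary real.
-/

namespace Summit.HubbardSuperconductivity.BirComplexStableXYNegative

open scoped BigOperators Topology
open MeasureTheory Literature.Probability.LatticeModels
open Summit.HubbardSuperconductivity.HubbardSuperconductivity.Theses.BalabanIR

noncomputable section

/-! ### Abstract kernel: holomorphy of `x ↦ ∫_S e^{-(A₀ + x A₁)}` on a compact set -/

/-- pointwise complex derivative of the affine-exponent Boltzmann weight `x ↦ e^{-(A₀ + x A₁)}`. -/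
theorem stiffHolo_hasDerivAt_exp_neg_affine (A₀ A₁ x : ℂ) :
    HasDerivAt (fun x : ℂ => Complex.exp (-(A₀ + x * A₁)))
      (Complex.exp (-(A₀ + x * A₁)) * (-A₁)) x := by
  have h1 : HasDerivAt (fun x : ℂ => x * A₁) A₁ x := by
    simpa only [one_mul] using (hasDerivAt_id' x).mul_const A₁
  exact (h1.const_add A₀).neg.cexp

/-- domination of the derivative `e^{-(A₀ + x A₁)} · (-A₁)` on the ball `‖x‖ ≤ R`. -/
theorem stiffHolo_norm_deriv_le (A₀ A₁ x : ℂ) {R : ℝ} (hx : ‖x‖ ≤ R) :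
    ‖Complex.exp (-(A₀ + x * A₁)) * (-A₁)‖ ≤ ‖A₁‖ * Real.exp (‖A₀‖ + R * ‖A₁‖) := by
  rw [norm_mul, norm_neg, Complex.norm_exp, mul_comm]
  gcongr
  calc (-(A₀ + x * A₁)).re ≤ ‖-(A₀ + x * A₁)‖ := Complex.re_le_norm _
    _ = ‖A₀ + x * A₁‖ := norm_neg _
    _ ≤ ‖A₀‖ + ‖x * A₁‖ := norm_add_le _ _
    _ = ‖A₀‖ + ‖x‖ * ‖A₁‖ := by rw [norm_mul]
    _ ≤ ‖A₀‖ + R * ‖A₁‖ := by gcongr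

/-- differentiation under the integral sign: for continuous `A₀ A₁` on a `T₂` space and a measure finite
on compacts, `x ↦ ∫_{S} e^{-(A₀ θ + x A₁ θ)}` over a compact `S` is complex differentiable everywhere. -/
theorem stiffHolo_differentiable_setIntegral_exp_neg_affine {X : Type*} [TopologicalSpace X]
    [MeasurableSpace X] [OpensMeasurableSpace X] [T2Space X] {μ : Measure X}
    [IsFiniteMeasureOnCompacts μ] {S : Set X} (hS : IsCompact S) {A₀ A₁ : X → ℂ}
    (h₀ : Continuous A₀) (h₁ : Continuous A₁) :
    Differentiable ℂ (fun x : ℂ => ∫ θ in S, Complex.exp (-(A₀ θ + x * A₁ θ)) ∂μ) := by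
  intro x₀
  have hFc : ∀ x : ℂ, Continuous fun θ => Complex.exp (-(A₀ θ + x * A₁ θ)) := fun x => by
    fun_prop
  have hF'c : ∀ x : ℂ, Continuous fun θ => Complex.exp (-(A₀ θ + x * A₁ θ)) * (-A₁ θ) := fun x => by
    fun_prop
  have hbc : Continuous fun θ => ‖A₁ θ‖ * Real.exp (‖A₀ θ‖ + (‖x₀‖ + 1) * ‖A₁ θ‖) := by
    fun_prop
  have key := hasDerivAt_integral_of_dominated_loc_of_deriv_le
    (μ := μ.restrict S) (x₀ := x₀) (s := Metric.ball x₀ 1)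
    (F := fun (x : ℂ) (θ : X) => Complex.exp (-(A₀ θ + x * A₁ θ)))
    (F' := fun (x : ℂ) (θ : X) => Complex.exp (-(A₀ θ + x * A₁ θ)) * (-A₁ θ))
    (bound := fun θ => ‖A₁ θ‖ * Real.exp (‖A₀ θ‖ + (‖x₀‖ + 1) * ‖A₁ θ‖))
    (Metric.ball_mem_nhds x₀ one_pos)
    (Filter.Eventually.of_forall fun x => (hFc x).aestronglyMeasurable)
    ((hFc x₀).continuousOn.integrableOn_compact hS)
    (hF'c x₀).aestronglyMeasurable
    (Filter.Eventually.of_forall fun θ x hx => by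
      refine stiffHolo_norm_deriv_le (A₀ θ) (A₁ θ) x ?_
      have hx' : dist x x₀ < 1 := Metric.mem_ball.1 hx
      calc ‖x‖ = ‖x₀ + (x - x₀)‖ := by rw [add_sub_cancel]
        _ ≤ ‖x₀‖ + ‖x - x₀‖ := norm_add_le _ _
        _ ≤ ‖x₀‖ + 1 := by rw [← dist_eq_norm]; exact add_le_add le_rfl hx'.le)
    (hbc.continuousOn.integrableOn_compact hS)
    (Filter.Eventually.of_forall fun θ x _ => stiffHolo_hasDerivAt_exp_neg_affine (A₀ θ) (A₁ θ) x)
  exact key.2.differentiableAt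

/-! ### The action is linear in the table and continuous in the configuration -/

/-- the action is additive in the table. -/
theorem stiffHolo_action_add {r : ℕ} (K : ℝ) (c₁ c₂ : Table r) (L M : ℕ) [NeZero L] [NeZero M]
    (θ : Λ L M → ℝ) : action K (c₁ + c₂) L M θ = action K c₁ L M θ + action K c₂ L M θ := by
  unfold action
  simp only [genF_add, Finset.sum_add_distrib, mul_add]

/-- the action is homogeneous in the table. -/
theorem stiffHolo_action_smul {r : ℕ} (K : ℝ) (b : ℂ) (c : Table r) (L M : ℕ) [NeZero L] [NeZero M]
    (θ : Λ L M → ℝ) : action K (b • c) L M θ = b * action K c L M θ := by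
  unfold action
  simp only [genF_smul, ← Finset.mul_sum]
  ring

/-- the action of any table is continuous in the configuration. -/
theorem stiffHolo_continuous_action {r : ℕ} (K : ℝ) (c : Table r) (L M : ℕ) [NeZero L] [NeZero M] :
    Continuous fun θ : Λ L M → ℝ => action K c L M θ := by
  unfold action
  fun_prop

/-- the stiffness-deformed action is affine in the complex stiffness `a`:
`A(c_a) = (A(spatialTab) + iε₂ A(temporalSinTab)) + a · A(temporalCosTab)`. -/
theorem stiffHolo_action_eq (K ε₂ : ℝ) (L M : ℕ) [NeZero L] [NeZero M] (a : ℂ) (θ : Λ L M → ℝ) :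
    action K (spatialTab + a • temporalCosTab + (Complex.I * ε₂) • temporalSinTab) L M θ =
      (action K spatialTab L M θ + (Complex.I * ε₂) * action K temporalSinTab L M θ)
        + a * action K temporalCosTab L M θ := by
  simp only [stiffHolo_action_add, stiffHolo_action_smul]
  ring

/-! ### Main theorem -/

/-- Holomorphy of `Z` in the complex temporal stiffness: for every real `K, ε₂` and every torus
`(ℤ/L)² × ℤ/M`, the map `a ↦ partZ K (spatialTab + a • temporalCosTab + (iε₂) • temporalSinTab) L M`
is complex differentiable on all of `ℂ` (differentiation under the integral sign on the compact cube). -/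
theorem differentiable_partZ_stiffness (K ε₂ : ℝ) (L M : ℕ) [NeZero L] [NeZero M] :
    Differentiable ℂ (fun a : ℂ =>
      partZ K (spatialTab + a • temporalCosTab + (Complex.I * ε₂) • temporalSinTab) L M) := by
  have hK : IsCompact (cube L M) := isCompact_univ_pi fun _ => isCompact_Icc
  have h := stiffHolo_differentiable_setIntegral_exp_neg_affine (μ := volume) hK
    (A₀ := fun θ : Λ L M → ℝ =>
      action K spatialTab L M θ + (Complex.I * ε₂) * action K temporalSinTab L M θ)
    (A₁ := fun θ : Λ L M → ℝ => action K temporalCosTab L M θ)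
    (by
      have h1 := stiffHolo_continuous_action K spatialTab L M
      have h2 := stiffHolo_continuous_action K temporalSinTab L M
      fun_prop)
    (stiffHolo_continuous_action K temporalCosTab L M)
  simp only [partZ, stiffHolo_action_eq]
  exact h

/-- Registered stub signature (line `theta-rotor-equimodular-zeros`): holomorphy of the witness
partition function in the complex temporal stiffness. -/
theorem stub_partZ_stiff_differentiable :
    ∀ (K ε₂ : ℝ) (L M : ℕ) [NeZero L] [NeZero M],
      Differentiable ℂ (fun a : ℂ =>
        partZ K (spatialTab + a • temporalCosTab + (Complex.I * ε₂) • temporalSinTab) L M) :=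
  fun K ε₂ L M _ _ => differentiable_partZ_stiffness K ε₂ L M

end

end Summit.HubbardSuperconductivity.BirComplexStableXYNegative
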